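import Literature.NumberTheory.DiophantineApproximation.DiscrepancyConcentration
import Mathlib.MeasureTheory.Measure.Count
import Mathlib.Tactic
import HarnessLib

/-!
# Measure concentration of the box discrepancy on the grid `(ℤ/D)ⁿ ∩ [0,1)ⁿ` (CDT §6.3)

Calegari–Dimitrov–Tang, arXiv:2408.15403, §6.2–6.3 use Theorem 45 (concentration of the box
discrepancy, `DiscrepancyConcentration`) to count the **lattice points** `𝐤 ∈ {0,…,D−1}^d` with
`𝐤/D ∈ P_ε^d = {D(𝐭) < ε}` ("the number `N` of free parameters `c_{𝐢,𝐤}` … will exceed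
`((m − δ/2)D)^d`", proof of Lemma 61, p. 50), i.e. Theorem 45 for the uniform probability measure
on the grid `{0, 1/D, …, (D−1)/D}^d` rather than Lebesgue measure. The proof of Theorem 45 in
`DiscrepancyConcentration` (LeVeque + Hoeffding) goes through verbatim for any product
probability measure whose marginals live in `[0,1)` and annihilate the characters
`e(hx)`, `1 ≤ h ≤ K(ε) = ⌈12/(π²ε³)⌉`; for the grid this holds as soon as `D > K(ε)` (sums of
roots of unity). This file records that variant and its counting form:

* `Discrepancy.gridMeasure D`, `Discrepancy.gridCube n D` — uniform measure on the grid, its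
  marginals (`integral_comp_eval_gridCube`), vanishing character sums
  (`sum_cos_grid_eq_zero`, `sum_sin_grid_eq_zero`).
* `Discrepancy.measureReal_discrepancy_ge_le_grid` — `P_grid(D(t) ≥ ε) ≤ 8 e^{−ε⁴n/64}` for
  `D > K(ε)`.
* `Discrepancy.card_discrepancy_ge_le_grid` — the counting form
  `#{𝐤 ∈ {0,…,D−1}ⁿ : D(𝐤/D) ≥ ε} ≤ 8 e^{−ε⁴n/64} Dⁿ` (`D > K(ε)`).

No named facts.

## References

* [CalegariDimitrovTang2024] arXiv:2408.15403, §4.2 Theorem 45 (p. 42); §6.2 eq. (6.4)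
  (`P_ε^d`), §6.3 proof of Lemma 61 (p. 50).
-/

noncomputable section

open MeasureTheory Set Filter Topology

open scoped ENNReal

namespace Literature.NumberTheory.DiophantineApproximation

namespace Discrepancy

section Grid

open ProbabilityTheory

variable {n : ℕ}

/-! ### The uniform measure on the grid `{0, 1/D, …, (D−1)/D}` -/

/-- The uniform probability measure on the grid `{k/D : k < D} ⊂ [0,1)`. [folklore] -/
def gridMeasure (D : ℕ) : Measure ℝ :=
  ((D : ℝ≥0∞)⁻¹) • ∑ k ∈ Finset.range D, Measure.dirac ((k : ℝ) / D)

/-- The grid measure is a probability measure (`D ≥ 1`). [folklore] -/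
instance isProbabilityMeasure_gridMeasure (D : ℕ) [NeZero D] :
    IsProbabilityMeasure (gridMeasure D) := by
  constructor
  rw [gridMeasure, Measure.smul_apply, Measure.finsetSum_apply]
  simp only [measure_univ, Finset.sum_const, Finset.card_range, smul_eq_mul, nsmul_eq_mul, mul_one]
  exact ENNReal.inv_mul_cancel (by simp [NeZero.ne D]) (ENNReal.natCast_ne_top D)

/-- Integrals against the grid measure are averages over the grid. [folklore] -/
theorem integral_gridMeasure (D : ℕ) (g : ℝ → ℝ) :
    ∫ x, g x ∂(gridMeasure D) = (D : ℝ)⁻¹ * ∑ k ∈ Finset.range D, g ((k : ℝ) / D) := by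
  rw [gridMeasure, integral_smul_measure, integral_finsetSum_measure (fun k _ => integrable_dirac
    (by simp))]
  simp only [integral_dirac]
  rw [ENNReal.toReal_inv, ENNReal.toReal_natCast, smul_eq_mul]

/-- The uniform probability measure on the grid `{0, 1/D, …, (D−1)/D}ⁿ ⊂ [0,1)ⁿ`. [folklore] -/
def gridCube (n D : ℕ) : Measure (Fin n → ℝ) :=
  Measure.pi fun _ : Fin n => gridMeasure D

/-- The grid cube measure is a probability measure. [folklore] -/
instance isProbabilityMeasure_gridCube (n D : ℕ) [NeZero D] : IsProbabilityMeasure (gridCube n D) := by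
  unfold gridCube; infer_instance

/-- Marginals of the grid cube. [folklore] -/
theorem integral_comp_eval_gridCube {D : ℕ} [NeZero D] (g : ℝ → ℝ) (hg : Measurable g) (i : Fin n) :
    ∫ t, g (t i) ∂(gridCube n D) = (D : ℝ)⁻¹ * ∑ k ∈ Finset.range D, g ((k : ℝ) / D) := by
  have h := (measurePreserving_eval (fun _ : Fin n => gridMeasure D) i).map_eq
  unfold gridCube
  rw [← integral_map (measurable_pi_apply i).aemeasurable hg.aestronglyMeasurable, h,
    integral_gridMeasure]

/-! ### Vanishing character sums over the grid -/

/-- `Σ_{k<D} e(hk/D) = 0` when `D ∤ h`. [folklore] -/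
theorem sum_exp_grid_eq_zero {D : ℕ} {h : ℤ} (hD : ¬ (D : ℤ) ∣ h) :
    ∑ k ∈ Finset.range D, Complex.exp (2 * Real.pi * Complex.I * h * (((k : ℝ) / D : ℝ) : ℂ)) = 0 := by
  rcases Nat.eq_zero_or_pos D with hD0 | hD0
  · subst hD0; simp
  set ζ : ℂ := Complex.exp (2 * Real.pi * Complex.I * h / D) with hζ
  have hterm : ∀ k : ℕ, Complex.exp (2 * Real.pi * Complex.I * h * (((k : ℝ) / D : ℝ) : ℂ)) = ζ ^ k := by
    intro k
    rw [hζ, ← Complex.exp_nat_mul]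
    congr 1
    push_cast
    field_simp
  simp_rw [hterm]
  have hζ1 : ζ ≠ 1 := by
    intro h1
    rw [hζ, Complex.exp_eq_one_iff] at h1
    obtain ⟨q, hq⟩ := h1
    apply hD
    have hD' : (D : ℂ) ≠ 0 := by exact_mod_cast hD0.ne'
    have h2πi : (2 * Real.pi * Complex.I : ℂ) ≠ 0 := by
      simp [Real.pi_ne_zero, Complex.I_ne_zero]
    have e1 : (2 * Real.pi * Complex.I) * ((h : ℂ) / D) = (2 * Real.pi * Complex.I) * q := by
      rw [mul_div_assoc] at hq; rw [hq]; ring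
    have e2 : (h : ℂ) / D = q := mul_left_cancel₀ h2πi e1
    rw [div_eq_iff hD'] at e2
    have e3 : h = q * D := by exact_mod_cast e2
    exact ⟨q, by rw [e3]; ring⟩
  have hζD : ζ ^ D = 1 := by
    rw [hζ, ← Complex.exp_nat_mul, Complex.exp_eq_one_iff]
    refine ⟨h, ?_⟩
    have hD' : (D : ℂ) ≠ 0 := by exact_mod_cast hD0.ne'
    field_simp
  have := geom_sum_eq hζ1 D
  rw [this, hζD, sub_self, zero_div]

/-- `Σ_{k<D} cos(2πhk/D) = 0` when `D ∤ h`. [folklore] -/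
theorem sum_cos_grid_eq_zero {D : ℕ} {h : ℤ} (hD : ¬ (D : ℤ) ∣ h) :
    ∑ k ∈ Finset.range D, Real.cos (2 * Real.pi * h * ((k : ℝ) / D)) = 0 := by
  have := congrArg Complex.re (sum_exp_grid_eq_zero hD)
  rw [Complex.re_sum, Complex.zero_re] at this
  rw [← this]
  refine Finset.sum_congr rfl fun k _ => ?_
  rw [show (2 * Real.pi * Complex.I * h * (((k : ℝ) / D : ℝ) : ℂ)) =
      ((2 * Real.pi * h * ((k : ℝ) / D) : ℝ) : ℂ) * Complex.I by push_cast; ring, Complex.exp_mul_I]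
  simp only [Complex.add_re, Complex.mul_re, Complex.I_re, Complex.I_im, mul_zero, mul_one,
    sub_zero, ← Complex.ofReal_cos, ← Complex.ofReal_sin, Complex.ofReal_re, Complex.ofReal_im]
  ring

/-- `Σ_{k<D} sin(2πhk/D) = 0` when `D ∤ h`. [folklore] -/
theorem sum_sin_grid_eq_zero {D : ℕ} {h : ℤ} (hD : ¬ (D : ℤ) ∣ h) :
    ∑ k ∈ Finset.range D, Real.sin (2 * Real.pi * h * ((k : ℝ) / D)) = 0 := by
  have := congrArg Complex.im (sum_exp_grid_eq_zero hD)
  rw [Complex.im_sum, Complex.zero_im] at this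
  rw [← this]
  refine Finset.sum_congr rfl fun k _ => ?_
  rw [show (2 * Real.pi * Complex.I * h * (((k : ℝ) / D : ℝ) : ℂ)) =
      ((2 * Real.pi * h * ((k : ℝ) / D) : ℝ) : ℂ) * Complex.I by push_cast; ring, Complex.exp_mul_I]
  simp only [Complex.add_im, Complex.mul_im, Complex.I_re, Complex.I_im, mul_zero, mul_one,
    add_zero, zero_add, ← Complex.ofReal_cos, ← Complex.ofReal_sin, Complex.ofReal_re,
    Complex.ofReal_im]

/-- Small non-zero frequencies are not multiples of `D`. [folklore] -/
theorem not_dvd_of_lt {D : ℕ} {h : ℕ} (h1 : 1 ≤ h) (hD : h < D) : ¬ (D : ℤ) ∣ (h : ℤ) := by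
  intro hdvd
  have := Int.le_of_dvd (by exact_mod_cast h1) hdvd
  omega

/-! ### Hoeffding on the grid -/

/-- The coordinate cosines are centred and `[−1,1]`-valued on the grid (`D ∤ h`), hence
sub-Gaussian with parameter `1`. [folklore] -/
theorem hasSubgaussianMGF_cos_grid {D : ℕ} [NeZero D] {h : ℤ} (hD : ¬ (D : ℤ) ∣ h) (i : Fin n) :
    HasSubgaussianMGF (fun t : Fin n → ℝ => Real.cos (2 * Real.pi * h * t i)) 1 (gridCube n D) := by
  have hmeas : Measurable fun t : Fin n → ℝ => Real.cos (2 * Real.pi * h * t i) :=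
    Real.measurable_cos.comp ((measurable_pi_apply i).const_mul _)
  have h1 := hasSubgaussianMGF_of_mem_Icc_of_integral_eq_zero (μ := gridCube n D) (a := -1) (b := 1)
    hmeas.aemeasurable (ae_of_all _ fun t => ⟨Real.neg_one_le_cos _, Real.cos_le_one _⟩) (by
      have := integral_comp_eval_gridCube (D := D) (fun x => Real.cos (2 * Real.pi * h * x))
        (Real.measurable_cos.comp (measurable_id.const_mul _)) i
      rw [this, sum_cos_grid_eq_zero hD, mul_zero])
  convert h1 using 2
  norm_num

/-- The coordinate sines are sub-Gaussian with parameter `1` on the grid (`D ∤ h`). [folklore] -/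
theorem hasSubgaussianMGF_sin_grid {D : ℕ} [NeZero D] {h : ℤ} (hD : ¬ (D : ℤ) ∣ h) (i : Fin n) :
    HasSubgaussianMGF (fun t : Fin n → ℝ => Real.sin (2 * Real.pi * h * t i)) 1 (gridCube n D) := by
  have hmeas : Measurable fun t : Fin n → ℝ => Real.sin (2 * Real.pi * h * t i) :=
    Real.measurable_sin.comp ((measurable_pi_apply i).const_mul _)
  have h1 := hasSubgaussianMGF_of_mem_Icc_of_integral_eq_zero (μ := gridCube n D) (a := -1) (b := 1)
    hmeas.aemeasurable (ae_of_all _ fun t => ⟨Real.neg_one_le_sin _, Real.sin_le_one _⟩) (by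
      have := integral_comp_eval_gridCube (D := D) (fun x => Real.sin (2 * Real.pi * h * x))
        (Real.measurable_sin.comp (measurable_id.const_mul _)) i
      rw [this, sum_sin_grid_eq_zero hD, mul_zero])
  convert h1 using 2
  norm_num

/-- One-sided Hoeffding bound on the grid cube: `P(Σᵢ g(tᵢ) ≥ a) ≤ exp(−a²/(2n))` for independent
coordinate functions of sub-Gaussian parameter `1`. [folklore] -/
theorem measureReal_sum_ge_le_grid {D : ℕ} [NeZero D] {g : ℝ → ℝ} (hg : Measurable g)
    (hsub : ∀ i : Fin n, HasSubgaussianMGF (fun t : Fin n → ℝ => g (t i)) 1 (gridCube n D))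
    {a : ℝ} (ha : 0 ≤ a) :
    (gridCube n D).real {t | a ≤ ∑ i, g (t i)} ≤ Real.exp (-a ^ 2 / (2 * n)) := by
  have hind : iIndepFun (fun i (t : Fin n → ℝ) => g (t i)) (gridCube n D) := by
    unfold gridCube
    exact iIndepFun_pi fun i => hg.aemeasurable
  have h := HasSubgaussianMGF.measure_sum_ge_le_of_iIndepFun hind (c := fun _ => 1) (s := Finset.univ)
    (fun i _ => hsub i) ha
  simpa using h

/-- **CDT Lemma 47 on the grid**: `P(|S_h| ≥ δ n) ≤ 4 exp(−δ² n/8)` for the Weyl sums of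
independent uniform grid points, `D ∤ h`, `δ ≥ 0`.
[cite: CalegariDimitrovTang2024, §4.2 Lemma 47 (p. 42)] -/
theorem measureReal_norm_weylSum_ge_le_grid {D : ℕ} [NeZero D] {h : ℤ} (hD : ¬ (D : ℤ) ∣ h)
    {δ : ℝ} (hδ : 0 ≤ δ) :
    (gridCube n D).real {t | δ * n ≤ ‖weylSum t h‖} ≤ 4 * Real.exp (-δ ^ 2 * n / 8) := by
  set C : (Fin n → ℝ) → ℝ := fun t => ∑ i, Real.cos (2 * Real.pi * h * t i) with hC
  set S : (Fin n → ℝ) → ℝ := fun t => ∑ i, Real.sin (2 * Real.pi * h * t i) with hS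
  have hre : ∀ t : Fin n → ℝ, (weylSum t h).re = C t := by
    intro t
    simp only [weylSum, Complex.re_sum, hC]
    refine Finset.sum_congr rfl fun i _ => ?_
    rw [show (2 * Real.pi * Complex.I * h * (t i : ℂ)) = ((2 * Real.pi * h * t i : ℝ) : ℂ) * Complex.I by
      push_cast; ring, Complex.exp_mul_I]
    simp only [Complex.add_re, Complex.mul_re, Complex.I_re, Complex.I_im, mul_zero, mul_one,
      sub_zero, ← Complex.ofReal_cos, ← Complex.ofReal_sin, Complex.ofReal_re,
      Complex.ofReal_im]
    ring
  have him : ∀ t : Fin n → ℝ, (weylSum t h).im = S t := by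
    intro t
    simp only [weylSum, Complex.im_sum, hS]
    refine Finset.sum_congr rfl fun i _ => ?_
    rw [show (2 * Real.pi * Complex.I * h * (t i : ℂ)) = ((2 * Real.pi * h * t i : ℝ) : ℂ) * Complex.I by
      push_cast; ring, Complex.exp_mul_I]
    simp only [Complex.add_im, Complex.mul_im, Complex.I_re, Complex.I_im, mul_zero, mul_one,
      add_zero, zero_add, ← Complex.ofReal_cos, ← Complex.ofReal_sin, Complex.ofReal_re,
      Complex.ofReal_im]
  have hsub : {t : Fin n → ℝ | δ * n ≤ ‖weylSum t h‖} ⊆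
      ({t | δ * n / 2 ≤ ∑ i, Real.cos (2 * Real.pi * h * t i)} ∪
        {t | δ * n / 2 ≤ ∑ i, -Real.cos (2 * Real.pi * h * t i)}) ∪
      ({t | δ * n / 2 ≤ ∑ i, Real.sin (2 * Real.pi * h * t i)} ∪
        {t | δ * n / 2 ≤ ∑ i, -Real.sin (2 * Real.pi * h * t i)}) := by
    intro t ht
    simp only [Set.mem_setOf_eq] at ht
    simp only [Set.mem_union, Set.mem_setOf_eq, Finset.sum_neg_distrib]
    have h1 : ‖weylSum t h‖ ≤ |(weylSum t h).re| + |(weylSum t h).im| :=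
      Complex.norm_le_abs_re_add_abs_im _
    rw [hre, him] at h1
    by_contra hcon
    push Not at hcon
    obtain ⟨⟨h2, h3⟩, h4, h5⟩ := hcon
    have hC' : |C t| < δ * n / 2 := abs_lt.mpr ⟨by linarith, h2⟩
    have hS' : |S t| < δ * n / 2 := abs_lt.mpr ⟨by linarith, h4⟩
    linarith
  have hmc : Measurable fun x : ℝ => Real.cos (2 * Real.pi * h * x) :=
    Real.measurable_cos.comp (measurable_id.const_mul _)
  have hms : Measurable fun x : ℝ => Real.sin (2 * Real.pi * h * x) :=
    Real.measurable_sin.comp (measurable_id.const_mul _)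
  have ha : 0 ≤ δ * n / 2 := by positivity
  have e : Real.exp (-(δ * n / 2) ^ 2 / (2 * n)) ≤ Real.exp (-δ ^ 2 * n / 8) := by
    rcases Nat.eq_zero_or_pos n with hn | hn
    · subst hn; simp
    · apply le_of_eq; congr 1
      have : (n : ℝ) ≠ 0 := by exact_mod_cast hn.ne'
      field_simp; ring
  have b1 := measureReal_sum_ge_le_grid (n := n) (D := D) hmc (fun i => hasSubgaussianMGF_cos_grid hD i) ha
  have b2 := measureReal_sum_ge_le_grid (n := n) (D := D) (g := fun x => -Real.cos (2 * Real.pi * h * x))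
    hmc.neg (fun i => (hasSubgaussianMGF_cos_grid hD i).neg) ha
  have b3 := measureReal_sum_ge_le_grid (n := n) (D := D) hms (fun i => hasSubgaussianMGF_sin_grid hD i) ha
  have b4 := measureReal_sum_ge_le_grid (n := n) (D := D) (g := fun x => -Real.sin (2 * Real.pi * h * x))
    hms.neg (fun i => (hasSubgaussianMGF_sin_grid hD i).neg) ha
  calc (gridCube n D).real {t | δ * n ≤ ‖weylSum t h‖}
      ≤ (gridCube n D).real (({t | δ * n / 2 ≤ ∑ i, Real.cos (2 * Real.pi * h * t i)} ∪
          {t | δ * n / 2 ≤ ∑ i, -Real.cos (2 * Real.pi * h * t i)}) ∪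
        ({t | δ * n / 2 ≤ ∑ i, Real.sin (2 * Real.pi * h * t i)} ∪
          {t | δ * n / 2 ≤ ∑ i, -Real.sin (2 * Real.pi * h * t i)})) :=
        measureReal_mono hsub
    _ ≤ ((gridCube n D).real {t | δ * n / 2 ≤ ∑ i, Real.cos (2 * Real.pi * h * t i)} +
          (gridCube n D).real {t | δ * n / 2 ≤ ∑ i, -Real.cos (2 * Real.pi * h * t i)}) +
        ((gridCube n D).real {t | δ * n / 2 ≤ ∑ i, Real.sin (2 * Real.pi * h * t i)} +
          (gridCube n D).real {t | δ * n / 2 ≤ ∑ i, -Real.sin (2 * Real.pi * h * t i)}) := by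
        refine (measureReal_union_le _ _).trans (add_le_add (measureReal_union_le _ _)
          (measureReal_union_le _ _))
    _ ≤ (Real.exp (-(δ * n / 2) ^ 2 / (2 * n)) + Real.exp (-(δ * n / 2) ^ 2 / (2 * n))) +
        (Real.exp (-(δ * n / 2) ^ 2 / (2 * n)) + Real.exp (-(δ * n / 2) ^ 2 / (2 * n))) :=
        add_le_add (add_le_add b1 b2) (add_le_add b3 b4)
    _ ≤ 4 * Real.exp (-δ ^ 2 * n / 8) := by linarith

/-! ### Theorem 45 on the grid -/

/-- **CDT Theorem 45 on the grid** (same proof as `measureReal_discrepancy_ge_le`): for the uniform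
probability measure on `{0, 1/D, …, (D−1)/D}ⁿ` with `D > K(ε) = ⌈12/(π²ε³)⌉`,
`P(D(t) ≥ ε) ≤ 8 exp(−ε⁴ n/64)`.
[cite: CalegariDimitrovTang2024, §4.2 Theorem 45 (p. 42); §6.3 proof of Lemma 61 (p. 50)] -/
theorem measureReal_discrepancy_ge_le_grid (n : ℕ) {D : ℕ} {ε : ℝ} (hε : 0 < ε)
    (hD : ⌈12 / (Real.pi ^ 2 * ε ^ 3)⌉₊ < D) :
    (gridCube n D).real {t | (∀ i, t i ∈ Ico (0 : ℝ) 1) ∧ ε ≤ boxDiscrepancy t} ≤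
      8 * Real.exp (-(ε ^ 4 * n / 64)) := by
  haveI : NeZero D := ⟨by omega⟩
  set E := {t : Fin n → ℝ | (∀ i, t i ∈ Ico (0 : ℝ) 1) ∧ ε ≤ boxDiscrepancy t} with hE
  have hprob : (gridCube n D).real E ≤ 1 := measureReal_le_one
  have hexp0 : 0 < Real.exp (-(ε ^ 4 * n / 64)) := Real.exp_pos _
  rcases lt_or_ge 1 ε with hε1 | hε1
  · have hempty : E = ∅ := by
      rw [hE, Set.eq_empty_iff_forall_notMem]
      intro t ht
      exact absurd (ht.2.trans (boxDiscrepancy_le_one t)) (not_le.mpr hε1)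
    rw [hempty, measureReal_empty]; positivity
  rcases Nat.eq_zero_or_pos n with hn | hn
  · subst hn
    simp only [Nat.cast_zero, mul_zero, zero_div, neg_zero, Real.exp_zero, mul_one]
    linarith
  set K := ⌈12 / (Real.pi ^ 2 * ε ^ 3)⌉₊ with hK
  set α := Real.pi ^ 2 * ε ^ 3 / (24 * harmonic K) with hα
  have hα0 : 0 < α := by
    have := alpha_ge hε hε1
    have : 0 < ε ^ 4 / 8 := by positivity
    linarith
  set F : ℕ → Set (Fin n → ℝ) := fun j => {t | Real.sqrt (α * (j + 1)) * n ≤ ‖weylSum t ((j + 1 : ℕ) : ℤ)‖}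
    with hF
  have hsubset : E ⊆ ⋃ j ∈ Finset.range K, F j := by
    intro t ht
    obtain ⟨h, h1, hK', hlt⟩ := exists_large_weylSum hn (fun i => (ht.1 i).1) (fun i => (ht.1 i).2)
      hε ht.2
    simp only [Set.mem_iUnion, Finset.mem_range, exists_prop]
    refine ⟨h - 1, by omega, ?_⟩
    simp only [hF, Set.mem_setOf_eq]
    have hh : (h - 1 + 1 : ℕ) = h := by omega
    rw [hh]
    have hcast : ((h - 1 : ℕ) : ℝ) + 1 = h := by
      rw [Nat.cast_sub h1]; push_cast; ring
    rw [hcast]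
    have hlt' : (Real.sqrt (α * h) * n) ^ 2 < ‖weylSum t h‖ ^ 2 := by
      rw [mul_pow, Real.sq_sqrt (by positivity)]
      rw [← hα] at hlt
      linarith
    exact le_of_lt (lt_of_pow_lt_pow_left₀ 2 (norm_nonneg _) hlt')
  set r := Real.exp (-(α * n / 8)) with hr
  have hr0 : 0 < r := Real.exp_pos _
  have hr1 : r < 1 := Real.exp_lt_one_iff.mpr (by
    have : (0 : ℝ) < n := by exact_mod_cast hn
    have := mul_pos hα0 this; linarith)
  have hFj : ∀ j : ℕ, j < K → (gridCube n D).real (F j) ≤ 4 * r ^ (j + 1) := by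
    intro j hj
    have hndvd : ¬ (D : ℤ) ∣ ((j + 1 : ℕ) : ℤ) := not_dvd_of_lt (by omega) (by omega)
    have h := measureReal_norm_weylSum_ge_le_grid (n := n) (D := D) hndvd (Real.sqrt_nonneg (α * (j + 1)))
    refine h.trans (le_of_eq ?_)
    rw [Real.sq_sqrt (by positivity), hr, ← Real.exp_nat_mul]
    congr 1
    push_cast
    ring
  have hunion : (gridCube n D).real E ≤ 4 * (r / (1 - r)) := by
    calc (gridCube n D).real E ≤ (gridCube n D).real (⋃ j ∈ Finset.range K, F j) :=
          measureReal_mono hsubset (measure_ne_top _ _)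
      _ ≤ ∑ j ∈ Finset.range K, (gridCube n D).real (F j) := measureReal_biUnion_finset_le _ _
      _ ≤ ∑ j ∈ Finset.range K, 4 * r ^ (j + 1) :=
          Finset.sum_le_sum fun j hj => hFj j (Finset.mem_range.mp hj)
      _ = 4 * r * ∑ j ∈ Finset.range K, r ^ j := by
          rw [Finset.mul_sum]
          exact Finset.sum_congr rfl fun j _ => by ring
      _ ≤ 4 * r * (1 - r)⁻¹ := by
          gcongr
          exact ((summable_geometric_of_lt_one hr0.le hr1).sum_le_tsum (Finset.range K)
            (fun j _ => pow_nonneg hr0.le j)).trans (tsum_geometric_of_lt_one hr0.le hr1).le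
      _ = 4 * (r / (1 - r)) := by rw [div_eq_mul_inv]; ring
  have h8 : (gridCube n D).real E ≤ 8 * r := by
    rcases le_or_gt r (1 / 2) with hhalf | hhalf
    · have : r / (1 - r) ≤ 2 * r := by
        rw [div_le_iff₀ (by linarith)]; nlinarith
      linarith
    · linarith
  have hrle : r ≤ Real.exp (-(ε ^ 4 * n / 64)) := by
    rw [hr, Real.exp_le_exp]
    have := alpha_ge hε hε1
    have hn' : (0 : ℝ) ≤ n := Nat.cast_nonneg n
    rw [← hα] at this
    have : ε ^ 4 / 8 * n ≤ α * n := mul_le_mul_of_nonneg_right this hn'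
    linarith
  linarith

/-! ### The counting form -/

/-- The grid embedding `𝐤 ↦ 𝐤/D`. [folklore] -/
def gridMap (n D : ℕ) (k : Fin n → Fin D) : Fin n → ℝ := fun i => ((k i : ℕ) : ℝ) / D

open Classical in
/-- One-dimensional grid measure of a measurable set: `D⁻¹ · #{k < D : k/D ∈ s}`. [folklore] -/
theorem gridMeasure_apply {D : ℕ} {s : Set ℝ} (hs : MeasurableSet s) :
    gridMeasure D s = (D : ℝ≥0∞)⁻¹ *
      ((Finset.univ.filter fun k : Fin D => ((k : ℕ) : ℝ) / D ∈ s).card : ℝ≥0∞) := by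
  classical
  rw [gridMeasure, Measure.smul_apply, Measure.finsetSum_apply, smul_eq_mul]
  congr 1
  simp only [Measure.dirac_apply' _ hs, Set.indicator_apply, Pi.one_apply]
  rw [Finset.sum_range (fun k => if ((k : ℝ) / D) ∈ s then (1 : ℝ≥0∞) else 0), Finset.card_filter]
  push_cast
  rfl

/-- The uniform probability measure on `{0,…,D−1}ⁿ` pushes forward to the grid cube measure.
[folklore] -/
theorem map_gridMap (n D : ℕ) [NeZero D] :
    (((D : ℝ≥0∞) ^ n)⁻¹ • (Measure.count : Measure (Fin n → Fin D))).map (gridMap n D) =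
      gridCube n D := by
  classical
  symm
  unfold gridCube
  refine Measure.pi_eq fun s hs => ?_
  rw [Measure.map_apply (measurable_of_finite _) (MeasurableSet.univ_pi hs), Measure.smul_apply,
    smul_eq_mul]
  have hpre : gridMap n D ⁻¹' (Set.univ.pi s) =
      ↑(Fintype.piFinset fun i => Finset.univ.filter fun k : Fin D => ((k : ℕ) : ℝ) / D ∈ s i) := by
    ext k
    simp [gridMap]
  rw [hpre, Measure.count_apply_finset, Fintype.card_piFinset]
  simp_rw [gridMeasure_apply (hs _)]
  rw [Finset.prod_mul_distrib, Finset.prod_const, Finset.card_univ, Fintype.card_fin, ENNReal.inv_pow]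
  push_cast
  ring

/-- **Counting form of Theorem 45** (as used in CDT §6.3): for `D > K(ε) = ⌈12/(π²ε³)⌉`, the number
of lattice points `𝐤 ∈ {0,…,D−1}ⁿ` whose scaled point `𝐤/D` has box discrepancy `≥ ε` is at most
`8 e^{−ε⁴ n/64} · Dⁿ`; equivalently `#{𝐤 : 𝐤/D ∈ P_εⁿ} ≥ (1 − 8e^{−ε⁴n/64}) Dⁿ`.
[cite: CalegariDimitrovTang2024, §6.3 proof of Lemma 61 (p. 50), with §4.2 Theorem 45] -/
theorem card_discrepancy_ge_le_grid (n : ℕ) {D : ℕ} {ε : ℝ} (hε : 0 < ε)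
    (hD : ⌈12 / (Real.pi ^ 2 * ε ^ 3)⌉₊ < D) :
    ((Finset.univ.filter fun k : Fin n → Fin D => ε ≤ boxDiscrepancy (gridMap n D k)).card : ℝ) ≤
      8 * Real.exp (-(ε ^ 4 * n / 64)) * (D : ℝ) ^ n := by
  classical
  haveI : NeZero D := ⟨by omega⟩
  have hDpos : (0 : ℝ) < D := by exact_mod_cast (show 0 < D by omega)
  set E := {t : Fin n → ℝ | (∀ i, t i ∈ Ico (0 : ℝ) 1) ∧ ε ≤ boxDiscrepancy t} with hE
  set μ : Measure (Fin n → Fin D) := ((D : ℝ≥0∞) ^ n)⁻¹ • Measure.count with hμ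
  -- the lattice points in question all map into `E`
  set S := Finset.univ.filter fun k : Fin n → Fin D => ε ≤ boxDiscrepancy (gridMap n D k) with hS
  have hSE : (S : Set (Fin n → Fin D)) ⊆ gridMap n D ⁻¹' E := by
    intro k hk
    simp only [Finset.coe_filter, Finset.mem_univ, true_and, Set.mem_setOf_eq, hS] at hk
    refine ⟨fun i => ⟨by simp only [gridMap]; positivity, ?_⟩, hk⟩
    simp only [gridMap]
    rw [div_lt_one hDpos]
    exact_mod_cast (k i).isLt
  -- `μ S ≤ μ (f⁻¹ E) ≤ (map f μ) E = gridCube E ≤ 8 e^{…}`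
  have h1 : μ S ≤ gridCube n D E := by
    calc μ S ≤ μ (gridMap n D ⁻¹' E) := measure_mono hSE
      _ ≤ (μ.map (gridMap n D)) E := Measure.le_map_apply (measurable_of_finite _).aemeasurable E
      _ = gridCube n D E := by rw [hμ, map_gridMap]
  have hμS : μ S = ((D : ℝ≥0∞) ^ n)⁻¹ * (S.card : ℝ≥0∞) := by
    rw [hμ, Measure.smul_apply, smul_eq_mul, Measure.count_apply_finset]
  have h2 : (gridCube n D).real E ≤ 8 * Real.exp (-(ε ^ 4 * n / 64)) :=
    measureReal_discrepancy_ge_le_grid n hε hD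
  have h3 : (μ S).toReal ≤ (gridCube n D).real E :=
    (ENNReal.toReal_le_toReal (by rw [hμS]; exact ENNReal.mul_ne_top (ENNReal.inv_ne_top.mpr
      (pow_ne_zero _ (by exact_mod_cast NeZero.ne D))) (ENNReal.natCast_ne_top _))
      (measure_ne_top _ _)).mpr h1
  have h4 : (μ S).toReal = (S.card : ℝ) / (D : ℝ) ^ n := by
    rw [hμS, ENNReal.toReal_mul, ENNReal.toReal_inv, ENNReal.toReal_pow, ENNReal.toReal_natCast,
      ENNReal.toReal_natCast, div_eq_inv_mul]
  rw [h4] at h3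
  have hDn : (0 : ℝ) < (D : ℝ) ^ n := by positivity
  rw [div_le_iff₀ hDn] at h3
  linarith [h3.trans (mul_le_mul_of_nonneg_right h2 hDn.le)]

end Grid

end Discrepancy

end Literature.NumberTheory.DiophantineApproximation
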